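import Literature.NumberTheory.Irrationality.LaiYu2020.NumberOfIrrationalOddZetaValues
import HarnessLib

/-!
# Lai–Yu 2020, §2: the reflection symmetry behind `R_n(−t−n) = −R_n(t)` — proofs

Topic `Literature/NumberTheory/Irrationality/LaiYu2020`. Companion ("Proofs") file of
`NumberOfIrrationalOddZetaValues.lean`, for L. Lai, P. Yu, *A note on the number of irrational odd
zeta values*, Compositio Math. **156** (2020) 1699–1717 = arXiv:1911.08458 [LaiYu2020], §2,
property (2) of the auxiliary functions `R_n` of Definition 2.3, read on the page (arXiv text p. 5):

> «(2) The auxiliary function `R_n(t)` has the following symmetry: `R_n(−t−n) = −R_n(t)`. In view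
> of the fact that `(2r+1)n` is even and `s` is odd, the proof is a straightforward computation.»

`R_n(t) = const · (t − rn) ∏_{θ ∈ 𝓕_B} ∏_{j=0}^{(2r+1)n−1} (t − rn + j + θ) / ∏_{j=0}^{n} (t+j)^{s+1}`.
The computation rests on two facts about the zero set, PROVED here (theorems only, no definitions,
no named facts; sorry-free):

* `one_mem_zeroSet`, `one_sub_mem_zeroSet` — `1 ∈ 𝓕_B` (`B ≥ 1`) and `θ ∈ 𝓕_B`, `θ < 1` imply
  `1 − θ ∈ 𝓕_B` (same reduced denominator);
* `numerator_reflect` — for ANY finite `F ⊂ (0, 1]` containing `1` and stable under `θ ↦ 1 − θ`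
  on `(0,1)`, any `c` and `M ≥ 1`: with `N(t) = (t − c) ∏_{θ ∈ F} ∏_{j<M} (t − c + j + θ)` and
  `n = M − 2c`, **`N(−t − n) = (−1)^{1 + M|F|} N(t)`** (the zero multiset `{c} ∪ {c − j − θ}` is
  stable under `z ↦ −n − z`); for `R_n`: `c = rn`, `M = (2r+1)n`, so `M − 2c = n`;
* `denominator_reflect` — `∏_{j=0}^{n} (−t − n + j) = (−1)^{n+1} ∏_{j=0}^{n} (t + j)`.

With `(2r+1)n` even and `s` odd the signs combine to `−1`; the statement for `R_n` itself is the
one-line corollary of these in the file defining `R_n` (`AuxiliaryFunction.lean`).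

## References

* [LaiYu2020] L. Lai, P. Yu, Compositio Math. 156 (2020) 1699–1717, §2, property (2) after Def. 2.3.
-/

open Finset

namespace Literature.NumberTheory.Irrationality.LaiYu2020

/-! ### `𝓕_B` is stable under `θ ↦ 1 − θ` -/

/-- `1 ∈ 𝓕_B` as soon as `B ≥ 1` (`1 = 1/1`, `φ(1) = 1`). [cite: LaiYu2020, Def. 2.1 (2)] -/
theorem one_mem_zeroSet {B : ℝ} (hB : 1 ≤ B) : (1 : ℚ) ∈ zeroSet B := by
  refine (mem_zeroSet).2 ⟨one_pos, le_rfl, ?_⟩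
  rw [Rat.den_ofNat, mem_denominatorSet, Nat.totient_one, Nat.cast_one]
  exact ⟨one_pos, hB⟩

/-- `θ ∈ 𝓕_B`, `θ < 1` imply `1 − θ ∈ 𝓕_B` (the reduced denominator of `1 − a/b` is again `b`).
[cite: LaiYu2020, Def. 2.1 (2)] -/
theorem one_sub_mem_zeroSet {B : ℝ} {θ : ℚ} (h : θ ∈ zeroSet B) (h1 : θ < 1) :
    1 - θ ∈ zeroSet B := by
  obtain ⟨hpos, hle, hden⟩ := (mem_zeroSet).1 h
  refine (mem_zeroSet).2 ⟨by linarith, by linarith, ?_⟩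
  have : (1 - θ).den = θ.den := by
    have h := Rat.intCast_sub_den 1 θ
    rwa [Int.cast_one] at h
  rwa [this]

/-! ### The reflection of the zero multiset -/

/-- **The numerator reflection**: for a finite `F ⊂ (0,1]` with `1 ∈ F` and `1 − θ ∈ F` whenever
`θ ∈ F`, `θ < 1`, any `c ∈ ℚ` and `M ≥ 1`,
`N(−t − (M − 2c)) = (−1)^{1 + M|F|} N(t)` for `N(t) = (t − c) ∏_{θ ∈ F} ∏_{j<M} (t − c + j + θ)`.
(For `R_n`: `F = 𝓕_B`, `c = rn`, `M = (2r+1)n`, `M − 2c = n`.)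
[cite: LaiYu2020, §2 property (2) after Def. 2.3] -/
theorem numerator_reflect (F : Finset ℚ) (hF : ∀ θ ∈ F, 0 < θ ∧ θ ≤ 1)
    (hsymm : ∀ θ ∈ F, θ < 1 → 1 - θ ∈ F) (h1 : (1 : ℚ) ∈ F) (c : ℚ) {M : ℕ} (hM : 1 ≤ M) (t : ℚ) :
    (-t - (M - 2 * c) - c) * ∏ θ ∈ F, ∏ j ∈ range M, (-t - (M - 2 * c) - c + j + θ) =
      (-1) ^ (1 + M * F.card) * ((t - c) * ∏ θ ∈ F, ∏ j ∈ range M, (t - c + j + θ)) := by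
  classical
  -- the zero set `Z = {c} ∪ {c - j - θ}`
  set g : ℚ × ℕ → ℚ := fun p => c - p.2 - p.1 with hg
  have hginj : Set.InjOn g ↑(F ×ˢ range M) := by
    rintro ⟨θ, j⟩ hp ⟨θ', j'⟩ hp' he
    simp only [coe_product, Set.mem_prod, mem_coe, mem_range] at hp hp'
    simp only [hg] at he
    obtain ⟨h0, h1'⟩ := hF θ hp.1
    obtain ⟨h0', h1''⟩ := hF θ' hp'.1
    -- `j + θ = j' + θ'` with `θ, θ' ∈ (0,1]` forces `j = j'`
    have hsum : (j : ℚ) + θ = j' + θ' := by linarith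
    have hj : j = j' := by
      have h2 : (j : ℚ) < j' + 1 := by linarith
      have h3 : (j' : ℚ) < j + 1 := by linarith
      have h2' : j < j' + 1 := by exact_mod_cast h2
      have h3' : j' < j + 1 := by exact_mod_cast h3
      omega
    subst hj
    have : θ = θ' := by linarith
    subst this
    rfl
  have hc : c ∉ (F ×ˢ range M).image g := by
    intro hc
    obtain ⟨⟨θ, j⟩, hp, he⟩ := mem_image.1 hc
    simp only [mem_product, mem_range] at hp
    simp only [hg] at he
    have := (hF θ hp.1).1
    have : (0 : ℚ) ≤ j := Nat.cast_nonneg _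
    linarith
  set Z : Finset ℚ := insert c ((F ×ˢ range M).image g) with hZ
  have hcardZ : Z.card = 1 + M * F.card := by
    rw [hZ, card_insert_of_notMem hc, card_image_of_injOn hginj, card_product, card_range]
    ring
  -- `N(t) = ∏_{z ∈ Z} (t - z)` for every `t`
  have hN : ∀ t : ℚ, (t - c) * ∏ θ ∈ F, ∏ j ∈ range M, (t - c + j + θ) = ∏ z ∈ Z, (t - z) := by
    intro t
    rw [hZ, prod_insert hc, prod_image hginj, prod_product]
    refine congrArg _ (prod_congr rfl fun θ _ => prod_congr rfl fun j _ => ?_)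
    simp only [hg]
    ring
  -- the reflection `σ z = 2c - M - z` preserves `Z`
  set σ : ℚ → ℚ := fun z => 2 * c - M - z with hσ
  have hσσ : ∀ z, σ (σ z) = z := fun z => by simp only [hσ]; ring
  have hσZ : ∀ z ∈ Z, σ z ∈ Z := by
    intro z hz
    rw [hZ, mem_insert, mem_image] at hz
    rw [hZ, mem_insert, mem_image]
    rcases hz with rfl | ⟨⟨θ, j⟩, hp, rfl⟩
    · -- `σ c = c - M = c - (M-1) - 1`
      refine Or.inr ⟨⟨1, M - 1⟩, mem_product.2 ⟨h1, mem_range.2 (by omega)⟩, ?_⟩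
      simp only [hg, hσ]
      rw [Nat.cast_sub hM]
      push_cast
      ring
    · simp only [mem_product, mem_range] at hp
      obtain ⟨hθF, hjM⟩ := hp
      obtain ⟨h0, hle⟩ := hF θ hθF
      rcases hle.lt_or_eq with hlt | heq
      · -- `θ < 1`: `σ(c - j - θ) = c - (M-1-j) - (1-θ)`
        refine Or.inr ⟨⟨1 - θ, M - 1 - j⟩, mem_product.2 ⟨hsymm θ hθF hlt, mem_range.2 (by omega)⟩, ?_⟩
        simp only [hg, hσ]
        rw [Nat.cast_sub (by omega : j ≤ M - 1), Nat.cast_sub hM]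
        push_cast
        ring
      · subst heq
        by_cases hj : j = M - 1
        · -- the lone zero `c`
          subst hj
          refine Or.inl ?_
          simp only [hg, hσ]
          rw [Nat.cast_sub hM]
          push_cast
          ring
        · refine Or.inr ⟨⟨1, M - 2 - j⟩, mem_product.2 ⟨h1, mem_range.2 (by omega)⟩, ?_⟩
          simp only [hg, hσ]
          rw [Nat.cast_sub (by omega : j ≤ M - 2), Nat.cast_sub (by omega : 2 ≤ M)]
          push_cast
          ring
  -- conclude
  have hlhs : (-t - (M - 2 * c) - c) * ∏ θ ∈ F, ∏ j ∈ range M, (-t - (M - 2 * c) - c + j + θ) =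
      ∏ z ∈ Z, ((-t - (M - 2 * c)) - z) := hN _
  rw [hlhs, hN t]
  calc ∏ z ∈ Z, (-t - ((M : ℚ) - 2 * c) - z) = ∏ z ∈ Z, ((-1) * (t - σ z)) := by
        refine prod_congr rfl fun z _ => ?_
        simp only [hσ]
        ring
    _ = (-1) ^ Z.card * ∏ z ∈ Z, (t - σ z) := by rw [prod_mul_distrib, prod_const]
    _ = (-1) ^ Z.card * ∏ z ∈ Z, (t - z) := by
        congr 1
        exact prod_nbij' σ σ hσZ hσZ (fun z _ => hσσ z) (fun z _ => hσσ z) fun z _ => rfl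
    _ = (-1) ^ (1 + M * F.card) * ∏ z ∈ Z, (t - z) := by rw [hcardZ]

/-- **The denominator reflection**: `∏_{j=0}^{n} (−t − n + j) = (−1)^{n+1} ∏_{j=0}^{n} (t + j)`.
[cite: LaiYu2020, §2 property (2) after Def. 2.3] -/
theorem denominator_reflect (n : ℕ) (t : ℚ) :
    ∏ j ∈ range (n + 1), (-t - n + j) = (-1) ^ (n + 1) * ∏ j ∈ range (n + 1), (t + j) := by
  rw [← prod_range_reflect (fun j => t + (j : ℚ)) (n + 1),
    show ((-1 : ℚ)) ^ (n + 1) = ∏ _j ∈ range (n + 1), (-1 : ℚ) by rw [prod_const, card_range],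
    ← prod_mul_distrib]
  refine prod_congr rfl fun j hj => ?_
  rw [mem_range] at hj
  rw [Nat.cast_sub (by omega : j ≤ n + 1 - 1), Nat.cast_sub (by omega : 1 ≤ n + 1)]
  push_cast
  ring

/-- The zero set `𝓕_B` (as any `Finset` enumerating it) satisfies the hypotheses of
`numerator_reflect` when `B ≥ 1`. [cite: LaiYu2020, Def. 2.1 (2)] -/
theorem zeroSet_reflect_hyps {B : ℝ} (hB : 1 ≤ B) (F : Finset ℚ) (hF : ∀ θ, θ ∈ F ↔ θ ∈ zeroSet B) :
    (∀ θ ∈ F, 0 < θ ∧ θ ≤ 1) ∧ (∀ θ ∈ F, θ < 1 → 1 - θ ∈ F) ∧ (1 : ℚ) ∈ F := by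
  refine ⟨fun θ hθ => ?_, fun θ hθ h1 => ?_, (hF 1).2 (one_mem_zeroSet hB)⟩
  · obtain ⟨h0, hle, -⟩ := (mem_zeroSet).1 ((hF θ).1 hθ)
    exact ⟨h0, hle⟩
  · exact (hF _).2 (one_sub_mem_zeroSet ((hF θ).1 hθ) h1)

end Literature.NumberTheory.Irrationality.LaiYu2020
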